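import Summits.QuantumFields.BalabanUV.T4Continuum.Support.SubstrateBackgroundTransporters

/-!
# SUBSTRATE — GAUGE COVARIANCE OF THE DICTIONARY: under a gauge transformation `u` of the background, the transporters conjugate
# site-wise and NE2's covariant difference ∕ covariant vector Laplacian OF THE GAUGE FIELD conjugate by the site multiplication
# operator `siteMul (ι ∘ u)` — `Δ_{U^u} = 𝒰·Δ_U·𝒰⁻¹` (follower of `SubstrateBackgroundTransporters`, item S-VOC-1, p217365)

Cell `pub-balaban`, SUBSTRATE cell, seat `b2b-balaban-substrate-p1`.  Summits-side under the LEAN PLACEMENT RULE (cell library).  HONEST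
FRAMING: rung (B)+1 of the FINITE-VOLUME T⁴ programme — NOT infinite volume, NOT a mass gap, NOT Clay; spine PROVED 0∕9.  Pure algebra of
the dictionary: nothing of the audited papers is asserted, no estimate.  HONEST DEPENDENCY (cell line, verbatim): continuum YM on T⁴ ⇐
BetaPertH ∧ nine spine estimates (0/9 proved); BetaPertH ⇐ (D1) ∧ (D4) ∧ CAP+tail; G-an2-4 gates asym, D1 and NE2/3/4.

WHAT.  For a SHIFT-COMPATIBLE chart `e : Site P j ≃ Tor N` (`e (x + e_ν) = e x + unitVec ν` — both charts of record are:
`shiftCompatible_siteTor`, `shiftCompatible_siteIdx`) and a representation `ι : G →* M_o(ℂ)`: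
* §1 the site gauge multipliers `gaugeMul e ι u i := ι (u (e⁻¹ i))`, `gaugeMulInv e ι u i := ι ((u (e⁻¹ i))⁻¹)`, inverse to each other
  under `siteMul` (`siteMul_gaugeMul_mul_inv`, `siteMul_gaugeMulInv_mul`); for unitary-valued `ι` they are adjoint to each other
  (`siteMul_gaugeMul_conjTranspose`);
* §2 THE GAUGE LAW OF THE COVARIANT DIFFERENCE: `covDc N c (transV e ι (U^u)) ν = siteMul (gaugeMul u) * covDc N c (transV e ι U) ν *
  siteMul (gaugeMulInv u)` (`covDc_gaugeAct`; [Balaban1985BackgroundPropagators] (3.28)–(3.31) p. 395 are the printed gauge laws — U → U^u (3.28);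
  Δ^η(U^u) = R(u)Δ^η(U)R(u⁻¹) (3.30); Δ^η_{U^u} = R(u)Δ^η_U R(u⁻¹) (3.31) — SHAPE only (DOCFIX-1, XREAD l.13536: v1 mis-cited «(3.5) p. 390»); the proof is `transV_gaugeAct` + `BlockMultiplication.kronShift_mul_siteMul`);
* §3 THE GAUGE LAW OF THE COVARIANT VECTOR LAPLACIAN for unitary-valued `ι`: `covLapOf e ι c (U^u) = siteMul (gaugeMul u) * covLapOf e ι c U
  * siteMul (gaugeMulInv u)` (`covLapOf_gaugeAct`) — so every gauge-invariant functional of `Δ_U` built downstream (spectra, Green's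
  function norms, traces) is a function of the gauge ORBIT of `U`, as [Balaban1987RG1] (0.24) p. 257 «gauge invariant functions of U»
  requires of the terms (shape; nothing asserted about Bałaban's terms).
Imports `SubstrateBackgroundTransporters` only; nothing existing is modified.
-/

noncomputable section

open scoped BigOperators Matrix Kronecker Matrix.Norms.L2Operator

namespace Summit.QuantumFields.BalabanUV.T4Continuum.SubstrateGaugeCovariance

open Literature.MathematicalPhysics.QuantumFieldTheory.Balaban1983to89
open Literature.MathematicalPhysics.QuantumFieldTheory.Balaban1983to89.B5Prop11Plancherel (Tor unitVec shiftM fdiff fine)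
open Literature.MathematicalPhysics.QuantumFieldTheory.Balaban1983to89.B5G183RateUnitTower (lev)
open Summit.QuantumFields.BalabanUV.T4Continuum.BlockMultiplication (siteMul siteMul_apply siteMul_one siteMul_mul siteMul_conjTranspose
  kronShift_mul_siteMul)
open Summit.QuantumFields.BalabanUV.T4Continuum.BlockPairingGeometry (tau)
open Summit.QuantumFields.BalabanUV.T4Continuum.ColourCovariantLaplacian (covDc covLapC)
open Summit.QuantumFields.BalabanUV.T4Continuum.SubstrateBackgroundTransporters

/-! ## §1 Shift-compatible charts and the site gauge multipliers -/

section Multipliers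

variable {P : Params} {j : ℕ} {N : Fin P.d → ℕ} (e : Site P j ≃ Tor N)
variable {G : Type*} [GaugeGroup G] {o : Type*} [Fintype o] [DecidableEq o] (ι : G →* Matrix o o ℂ)

/-- [folklore] A chart is SHIFT-COMPATIBLE when `Site.shift` is translation by the unit vector in the chart. -/
def ShiftCompatible (e : Site P j ≃ Tor N) : Prop := ∀ (x : Site P j) (ν : Fin P.d), e (x.shift ν) = e x + unitVec N ν

omit ι in
/-- [folklore] The definitional chart of record is shift-compatible (`siteTor_shift`). -/
theorem shiftCompatible_siteTor (P : Params) (j : ℕ) : ShiftCompatible (siteTor P j) := siteTor_shift P j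

omit ι in
/-- [folklore] The tower chart of record is shift-compatible (`siteIdx_shift`). -/
theorem shiftCompatible_siteIdx (P : Params) {j k : ℕ} (h : j + k = P.K) : ShiftCompatible (siteIdx P h) := siteIdx_shift P h

variable {e} in
omit ι in
/-- [folklore] In a shift-compatible chart the V2 neighbour `τ_ν i` is the chart of the V1-shifted site. -/
theorem symm_tau_fst (he : ShiftCompatible e) (ν : Fin P.d) (i : Tor N × Fin P.d) :
    e.symm (tau N ν i).1 = (e.symm i.1).shift ν := by
  apply e.injective
  rw [Equiv.apply_symm_apply, he, Equiv.apply_symm_apply]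
  rfl

/-- [folklore] THE SITE GAUGE MULTIPLIER of a gauge transformation `u`: `i ↦ ι (u (e⁻¹ i))` (component-blind). -/
def gaugeMul (u : GaugeTransf P j G) : Tor N × Fin P.d → Matrix o o ℂ := fun i => ι (u (e.symm i.1))

/-- [folklore] … and of its inverse: `i ↦ ι (u (e⁻¹ i)⁻¹)`. -/
def gaugeMulInv (u : GaugeTransf P j G) : Tor N × Fin P.d → Matrix o o ℂ := fun i => ι ((u (e.symm i.1))⁻¹)

/-- [folklore] `gaugeMul` unfolded. -/
@[simp] theorem gaugeMul_apply (u : GaugeTransf P j G) (i : Tor N × Fin P.d) : gaugeMul e ι u i = ι (u (e.symm i.1)) := rfl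

/-- [folklore] `gaugeMulInv` unfolded. -/
@[simp] theorem gaugeMulInv_apply (u : GaugeTransf P j G) (i : Tor N × Fin P.d) :
    gaugeMulInv e ι u i = ι ((u (e.symm i.1))⁻¹) := rfl

/-- [folklore] The multipliers are site-wise inverse to each other. -/
theorem gaugeMul_mul_gaugeMulInv (u : GaugeTransf P j G) (i : Tor N × Fin P.d) : gaugeMul e ι u i * gaugeMulInv e ι u i = 1 := by
  rw [gaugeMul_apply, gaugeMulInv_apply, ← map_mul, mul_inv_cancel, map_one]

/-- [folklore] … in both orders. -/
theorem gaugeMulInv_mul_gaugeMul (u : GaugeTransf P j G) (i : Tor N × Fin P.d) : gaugeMulInv e ι u i * gaugeMul e ι u i = 1 := by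
  rw [gaugeMul_apply, gaugeMulInv_apply, ← map_mul, inv_mul_cancel, map_one]

variable [hN : ∀ μ, NeZero (N μ)]

/-- [folklore] `siteMul (gaugeMul u) * siteMul (gaugeMulInv u) = 1`. -/
theorem siteMul_gaugeMul_mul_inv (u : GaugeTransf P j G) : siteMul (gaugeMul e ι u) * siteMul (gaugeMulInv e ι u) = 1 := by
  rw [siteMul_mul]
  conv_lhs => arg 1; ext i; rw [gaugeMul_mul_gaugeMulInv]
  exact siteMul_one

/-- [folklore] `siteMul (gaugeMulInv u) * siteMul (gaugeMul u) = 1`. -/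
theorem siteMul_gaugeMulInv_mul (u : GaugeTransf P j G) : siteMul (gaugeMulInv e ι u) * siteMul (gaugeMul e ι u) = 1 := by
  rw [siteMul_mul]
  conv_lhs => arg 1; ext i; rw [gaugeMulInv_mul_gaugeMul]
  exact siteMul_one

variable {ι} in
omit hN in
/-- [folklore] For unitary-valued `ι` the adjoint of the multiplier is the inverse multiplier (`ι(h⁻¹) = ι(h)ᴴ`,
`UnitaryModel.map_inv_eq_conjTranspose`). -/
theorem siteMul_gaugeMul_conjTranspose (hι : ∀ g, ι g ∈ Matrix.unitaryGroup o ℂ) (u : GaugeTransf P j G) :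
    (siteMul (gaugeMul e ι u))ᴴ = siteMul (gaugeMulInv e ι u) := by
  rw [siteMul_conjTranspose]
  congr 1
  funext i
  rw [gaugeMul_apply, gaugeMulInv_apply, UnitaryModel.map_inv_eq_conjTranspose ι hι]

variable {ι} in
omit hN in
/-- [folklore] … and symmetrically. -/
theorem siteMul_gaugeMulInv_conjTranspose (hι : ∀ g, ι g ∈ Matrix.unitaryGroup o ℂ) (u : GaugeTransf P j G) :
    (siteMul (gaugeMulInv e ι u))ᴴ = siteMul (gaugeMul e ι u) := by
  rw [← siteMul_gaugeMul_conjTranspose e hι, Matrix.conjTranspose_conjTranspose]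

end Multipliers

/-! ## §2 The gauge law of the covariant difference -/

section Difference

variable {P : Params} {j : ℕ} {N : Fin P.d → ℕ} [hN : ∀ μ, NeZero (N μ)] {e : Site P j ≃ Tor N}
variable {G : Type*} [GaugeGroup G] {o : Type*} [Fintype o] [DecidableEq o] (ι : G →* Matrix o o ℂ)

omit hN in
/-- [folklore] The transporters of `U^u`, as a site-wise triple product with the V2 neighbour in the last factor. -/
theorem transV_gaugeAct_eq (he : ShiftCompatible e) (u : GaugeTransf P j G) (U : GaugeField P j G) (ν : Fin P.d) :
    transV e ι (GaugeField.gaugeAct u U) ν =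
      fun i => gaugeMul e ι u i * transV e ι U ν i * gaugeMulInv e ι u (tau N ν i) := by
  funext i
  rw [transV_gaugeAct, gaugeMul_apply, gaugeMulInv_apply, symm_tau_fst he]

/-- [folklore] **THE GAUGE LAW OF THE COVARIANT DIFFERENCE**: `∇^{R(U^u)}_ν = 𝒰·∇^{R(U)}_ν·𝒰⁻¹` with `𝒰 = siteMul (ι ∘ u)` — the V2 reading
of the covariance of Bałaban's covariant derivative under `U ↦ U^u`, `f ↦ u·f`. -/
theorem covDc_gaugeAct (he : ShiftCompatible e) (c : ℂ) (u : GaugeTransf P j G) (U : GaugeField P j G) (ν : Fin P.d) :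
    covDc N c (transV e ι (GaugeField.gaugeAct u U)) ν =
      siteMul (gaugeMul e ι u) * covDc N c (transV e ι U) ν * siteMul (gaugeMulInv e ι u) := by
  have hsplit : siteMul (transV e ι (GaugeField.gaugeAct u U) ν) =
      siteMul (gaugeMul e ι u) * siteMul (transV e ι U ν) * siteMul (gaugeMulInv e ι u ∘ tau N ν) := by
    rw [transV_gaugeAct_eq ι he, siteMul_mul, siteMul_mul]
    rfl
  have hshift : siteMul (gaugeMulInv e ι u ∘ tau N ν) * shiftM N ν ⊗ₖ (1 : Matrix o o ℂ) =
      shiftM N ν ⊗ₖ (1 : Matrix o o ℂ) * siteMul (gaugeMulInv e ι u) :=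
    (kronShift_mul_siteMul N ν (gaugeMulInv e ι u)).symm
  -- abbreviations: V = multiplier, W = inverse multiplier, R = transporters of U, S = shift
  set V := siteMul (gaugeMul e ι u) with hV
  set W := siteMul (gaugeMulInv e ι u) with hW
  set R := siteMul (transV e ι U ν) with hR
  set S := shiftM N ν ⊗ₖ (1 : Matrix o o ℂ) with hS
  have hVW : V * W = 1 := siteMul_gaugeMul_mul_inv e ι u
  rw [covDc, covDc, hsplit, Matrix.mul_assoc (V * R) _ S, hshift, ← Matrix.mul_assoc (V * R) S W, Matrix.mul_assoc V R S]
  -- goal: c • (V * (R * S) * W - 1) = V * (c • (R * S - 1)) * W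
  rw [Matrix.mul_smul, Matrix.smul_mul, Matrix.mul_sub, Matrix.mul_one, Matrix.sub_mul, hVW]

end Difference

/-! ## §3 The gauge law of the covariant vector Laplacian of a gauge field -/

section Laplacian

variable {P : Params} {j : ℕ} {N : Fin P.d → ℕ} [hN : ∀ μ, NeZero (N μ)] {e : Site P j ≃ Tor N}
variable {G : Type*} [GaugeGroup G] {o : Type*} [Fintype o] [DecidableEq o] {ι : G →* Matrix o o ℂ}

/-- [folklore] For unitary-valued `ι`, each summand `(∇^R_ν)ᴴ∇^R_ν` conjugates: `(𝒰D𝒰⁻¹)ᴴ(𝒰D𝒰⁻¹) = 𝒰·DᴴD·𝒰⁻¹`. -/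
theorem conjTranspose_mul_covDc_gaugeAct (he : ShiftCompatible e) (hι : ∀ g, ι g ∈ Matrix.unitaryGroup o ℂ) (c : ℂ)
    (u : GaugeTransf P j G) (U : GaugeField P j G) (ν : Fin P.d) :
    (covDc N c (transV e ι (GaugeField.gaugeAct u U)) ν)ᴴ * covDc N c (transV e ι (GaugeField.gaugeAct u U)) ν =
      siteMul (gaugeMul e ι u) * ((covDc N c (transV e ι U) ν)ᴴ * covDc N c (transV e ι U) ν) * siteMul (gaugeMulInv e ι u) := by
  rw [covDc_gaugeAct ι he, Matrix.conjTranspose_mul, Matrix.conjTranspose_mul, siteMul_gaugeMulInv_conjTranspose e hι,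
    siteMul_gaugeMul_conjTranspose e hι]
  -- `V (Dᴴ W) (V D W) = V Dᴴ (W V) D W` with `W V = 1`
  set V := siteMul (gaugeMul e ι u) with hV
  set W := siteMul (gaugeMulInv e ι u) with hW
  set D := covDc N c (transV e ι U) ν with hD
  have hWV : W * V = 1 := siteMul_gaugeMulInv_mul e ι u
  simp only [Matrix.mul_assoc]
  rw [← Matrix.mul_assoc W V (D * W), hWV, Matrix.one_mul]

/-- [folklore] **THE GAUGE LAW OF `Δ_U`**: for a shift-compatible chart and unitary-valued `ι`,
`covLapOf e ι c (U^u) = siteMul (ι∘u) * covLapOf e ι c U * siteMul (ι∘u⁻¹)` — the shape of [Balaban1985BackgroundPropagators] (3.31) p. 395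
«Δ^η_{U^u} = R(u)Δ^η_U R(u⁻¹)» (nothing printed asserted). -/
theorem covLapOf_gaugeAct (he : ShiftCompatible e) (hι : ∀ g, ι g ∈ Matrix.unitaryGroup o ℂ) (c : ℂ) (u : GaugeTransf P j G)
    (U : GaugeField P j G) :
    covLapOf e ι c (GaugeField.gaugeAct u U) = siteMul (gaugeMul e ι u) * covLapOf e ι c U * siteMul (gaugeMulInv e ι u) := by
  simp only [covLapOf, covLapC]
  rw [Finset.mul_sum, Finset.sum_mul]
  exact Finset.sum_congr rfl fun ν _ => conjTranspose_mul_covDc_gaugeAct he hι c u U ν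

/-- [folklore] Consequently `Δ_{U^u}` and `Δ_U` are conjugate by an INVERTIBLE (indeed unitary) operator: `𝒰⁻¹·Δ_{U^u}·𝒰 = Δ_U`. -/
theorem covLapOf_gaugeAct_conj (he : ShiftCompatible e) (hι : ∀ g, ι g ∈ Matrix.unitaryGroup o ℂ) (c : ℂ) (u : GaugeTransf P j G)
    (U : GaugeField P j G) :
    siteMul (gaugeMulInv e ι u) * covLapOf e ι c (GaugeField.gaugeAct u U) * siteMul (gaugeMul e ι u) = covLapOf e ι c U := by
  rw [covLapOf_gaugeAct he hι]
  set V := siteMul (gaugeMul e ι u) with hV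
  set W := siteMul (gaugeMulInv e ι u) with hW
  have hWV : W * V = 1 := siteMul_gaugeMulInv_mul e ι u
  simp only [Matrix.mul_assoc]
  rw [hWV, Matrix.mul_one, ← Matrix.mul_assoc W V, hWV, Matrix.one_mul]

end Laplacian

end Summit.QuantumFields.BalabanUV.T4Continuum.SubstrateGaugeCovariance

end
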